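import Literature.NumberTheory.QuadraticForms.PadicSquares
import Literature.NumberTheory.EllipticCurves.QuadraticTwist
import Literature.NumberTheory.EllipticCurves.IrreducibleModPQuadraticTwistProofs
import HarnessLib

/-!
# Stub-ideation k = 1 (gen 8) for `stub_heegnerIndexLowerAtTwo` — crux `PrintCf2.SplitBadTwoLowerHalfOfFacts`
# (stmt-BirchSwinnertonDyer-27851), technique «weaken / strengthen»: CALIBRATION BY RIGIDITY
# (the weakest sufficient form of R47's «absolute pin of H_W / the NET table» is SHAPE + δ-RIGIDITY + ONE
# certified evaluation per δ-class; the strongest provable forms are kernel-checked below)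

Seat `sidea-stub_heegnerIndexLowerAtTwo-1-g8` (planner, stub-ideation; scratch sketch, NOT a proposal, NOT a
skeleton; nothing is asserted about the stub, the crux or BSD — BSD is NOT proved by any of this).

THE STEP (STUB-PLAN v2.2 node «HARDEST NOW» = T3's (W-b)′ ∧ the absolute pin of H_W = ONE per-key table of the
NET dyadic digit `e_A⁻ = (ε+ε′) − (ρ+ρ′)/2 + 2g` of S2′, R47; consumed by T3.5 `e_A⁻(k) + 1 ≥ 2·c_B(k)`).
S2′ is an EQUALITY law (`‖G(pt)‖ = 2^{−m/2}`, `m = 2A + 2s + e_A`), so by the critic's own B8 an anchor CALIBRATES it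
— provided (i) T3 is typed as an EQUALITY with an OPAQUE constant `e(W)` (the print theorems BDP-PJM Thm 2 /
Prop 2.20, CH18 4.9, de Shalit (36)–(37), CST are equalities «mod E^×»: SHAPE is print, VALUE is the research), and
(ii) `e(W)` is RIGID: a function of the dyadic key (the STUB-PLAN's standing claim «a number per key») and in fact
of `δ(W) ∈ {−1, 2, −2}` only (§A: keys pair up under the UNRAMIFIED quadratic twist at 2, under which Gauss sums,
ε-factors, Euler factors of ramified characters and the Katz periods change by 2-adic units). Then THREE certified
evaluations (anchors (1,7) = `cm7^{(−1)}`, N = 784; (0,7) = `cm7^{(−2)}`, N = 3136; one δ = 2 member) make the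
six-entry table a THEOREM (§B, §E `table_of_deltaRigid`), and the budget to decide is `2·c_B(k) ≤ T(δ k) + 3`
(§C: slack 3 through W0's `LowerTwists₊₁`, not 1; sharp), six `decide`s on three measured integers (§E
`lowerSucc_of_calibration`). §D proves the model half of rigidity: same key ⟹ the twists are ISOMORPHIC over `ℚ₂`
(`1 + 8ℤ₂ ⊆ ℤ₂²`, tree `padicInt_isSquare_of_toZModPow_three_eq_one`), δ-partners differ by the twist by `5`.

§A keys/δ/unramified pairing (decide) · §B calibration logic · §C budget slack 3 vs 1, both sharp · §D 2-adic
model rigidity (PROVED from tree lemmas) · §E the SHAPE + MEASURE frame and the assembled step (PROVED from the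
named hypotheses; research items are `Prop`-valued defs, no `∃`-frames, no `sorry`).
-/

set_option autoImplicit false
set_option linter.dupNamespace false

noncomputable section

namespace Summit.BirchSwinnertonDyer.BirchSwinnertonDyer.Cruxes.SplitBadTwoLowerHalfOfFacts.StubIdeasK1G8

/-! ### §A  The six dyadic keys = the classes of `d` in `ℚ₂ˣ/ℚ₂ˣ²` with `d ≢ 1 (mod 4)`; `δ`; the unramified pairing -/

/-- The dyadic keys `(1,7),(1,3),(0,1),(0,7),(0,3),(0,5)` of the class `cm7^{(d)}`, `d ≢ 1 (4)` squarefree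
(first coordinate: `d` odd; second: odd part of `d` mod 8). -/
inductive DyadicKey
  | k17 | k13 | k01 | k07 | k03 | k05
  deriving DecidableEq, Repr, Fintype

namespace DyadicKey

/-- Square-class representative of `d` in `ℚ₂ˣ/ℚ₂ˣ²` (odd keys: `d mod 8`; even keys: `2·(d/2 mod 8)`). -/
def rep : DyadicKey → ℤ
  | k17 => 7 | k13 => 3 | k01 => 2 | k07 => 14 | k03 => 6 | k05 => 10

/-- `δ(k) ∈ {−1, 2, −2}`: the twist making the partner `cm7^{(d/δ)}` GOOD at 2 (`d/δ ≡ 1 mod 4`). -/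
def delta : DyadicKey → ℤ
  | k17 => -1 | k13 => -1 | k01 => 2 | k05 => 2 | k07 => -2 | k03 => -2

/-- The `v`-conductor exponent `n_v(k)` of `ψ_{W,v}` (`χ₋₄`: 2 on δ = −1; `χ_{±8}`: 3 on δ = ±2). -/
def nv : DyadicKey → ℕ
  | k17 => 2 | k13 => 2 | k01 => 3 | k05 => 3 | k07 => 3 | k03 => 3

/-- The unramified partner: twist by the unramified class `5 ∈ ℚ₂ˣ/ℚ₂ˣ²` (`ℚ₂(√5)/ℚ₂` unramified). -/
def unr : DyadicKey → DyadicKey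
  | k17 => k13 | k13 => k17 | k01 => k05 | k05 => k01 | k07 => k03 | k03 => k07

theorem rep_div_delta_emod_four (k : DyadicKey) : (rep k / delta k) % 4 = 1 := by cases k <;> decide
theorem delta_mem (k : DyadicKey) : delta k = -1 ∨ delta k = 2 ∨ delta k = -2 := by cases k <;> decide
theorem delta_unr (k : DyadicKey) : delta (unr k) = delta k := by cases k <;> rfl
theorem nv_unr (k : DyadicKey) : nv (unr k) = nv k := by cases k <;> rfl
theorem unr_unr (k : DyadicKey) : unr (unr k) = k := by cases k <;> rfl
theorem unr_ne (k : DyadicKey) : unr k ≠ k := by cases k <;> decide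

/-- same `δ` ⟺ equal keys or unramified partners: the six keys are THREE δ-classes of size two. -/
theorem delta_eq_iff (k k' : DyadicKey) : delta k = delta k' ↔ (k' = k ∨ k' = unr k) := by
  cases k <;> cases k' <;> decide

/-- The partner's class IS the unramified class: `rep k · rep (unr k)` is `5 × (square)` in `ℚ₂`
(odd keys: `≡ 5 (mod 8)`; even keys: `4 × (≡ 5 mod 8)`). -/
theorem rep_mul_rep_unr (k : DyadicKey) :
    (rep k * rep (unr k)) % 8 = 5 ∨ (4 ∣ rep k * rep (unr k) ∧ (rep k * rep (unr k) / 4) % 8 = 5) := by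
  cases k <;> decide

/-- Within a key the class is trivial: `rep k · rep k` is a square times `1 mod 8` (odd) / `4·(1 mod 8)` (even). -/
theorem rep_mul_rep_self (k : DyadicKey) :
    (rep k * rep k) % 8 = 1 ∨ (4 ∣ rep k * rep k ∧ (rep k * rep k / 4) % 8 = 1) := by
  cases k <;> decide

/-- Three anchors cover the six keys through `δ`: `(1,7)` [`d = −1`, N = 784], `(0,7)` [`d = −2`, N = 3136],
`(0,5)` [`d ∈ {−6, 10, …}`, the δ = 2 class has NO member of conductor < 5000]. -/
theorem anchors_cover (k : DyadicKey) :
    delta k = delta k17 ∨ delta k = delta k07 ∨ delta k = delta k05 := by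
  cases k <;> decide

/-- the same statement as an anchor ASSIGNMENT: every key is an anchor key or its unramified partner. -/
theorem anchor_cases (k : DyadicKey) :
    ∃ a : DyadicKey, (a = k17 ∨ a = k07 ∨ a = k05) ∧ (k = a ∨ k = unr a) := by
  cases k
  · exact ⟨k17, Or.inl rfl, Or.inl rfl⟩
  · exact ⟨k17, Or.inl rfl, Or.inr rfl⟩
  · exact ⟨k05, Or.inr (Or.inr rfl), Or.inr rfl⟩
  · exact ⟨k07, Or.inr (Or.inl rfl), Or.inl rfl⟩
  · exact ⟨k07, Or.inr (Or.inl rfl), Or.inr rfl⟩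
  · exact ⟨k05, Or.inr (Or.inr rfl), Or.inl rfl⟩

end DyadicKey

/-! ### §B  CALIBRATION: a class-constant is pinned by ONE evaluation per class (the logic, kernel-checked) -/

section Calibration

variable {M K : Type*}

/-- Rigidity + one measured member per class ⟹ the table (Gross-1980-style: fix the constant of an identity by
evaluating both sides where they are independently computable). -/
theorem eq_table_of_rigid_of_anchor (cls : M → K) (ν : M → ℤ) (T : K → ℤ)
    (rigid : ∀ W W', cls W = cls W' → ν W = ν W')
    (anchor : ∀ W, ∃ W₀, cls W₀ = cls W ∧ ν W₀ = T (cls W₀)) :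
    ∀ W, ν W = T (cls W) := by
  intro W
  obtain ⟨W₀, hc, hv⟩ := anchor W
  rw [rigid W W₀ hc.symm, hv, hc]

/-- A normalisation slip (B15/B16) that is itself class-constant is INVISIBLE to calibration: the shifted digit is
rigid again, and the measured table absorbs the shift. -/
theorem rigid_add_classConst (cls : M → K) (ν : M → ℤ) (c : K → ℤ)
    (rigid : ∀ W W', cls W = cls W' → ν W = ν W') :
    ∀ W W', cls W = cls W' → ν W + c (cls W) = ν W' + c (cls W') := by
  intro W W' h
  rw [rigid W W' h, h]

end Calibration

/-! ### §C  The calibration inequality in its weakest sufficient form: slack 3 through W0, not 1 (k1-g2 H6 shape) -/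

/-- T3.5 as written = the defect-0 target through T0 alone: integrality gives slack `1`. -/
theorem lower_of_budget_one {g A s e n B cB : ℤ} (hS2 : 2 * g = 2 * A + 2 * s + e) (hB1 : g ≤ n)
    (hS3 : n ≤ B + s + cB) (hcal : 2 * cB ≤ e + 1) : A ≤ B := by
  omega

/-- With W0's target `LowerTwists₊₁` (admissible after R1, P-CT): slack `3` — one ℚ-level unit = two K₀-doubled
units on top of the integrality bit. -/
theorem lowerSucc_of_budget_three {g A s e n B cB : ℤ} (hS2 : 2 * g = 2 * A + 2 * s + e) (hB1 : g ≤ n)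
    (hS3 : n ≤ B + s + cB) (hcal : 2 * cB ≤ e + 3) : A ≤ B + 1 := by
  omega

/-- Slack 3 is SHARP for the `+1` target: at `2·c_B = e + 4` the hypotheses allow `A = B + 2`. -/
theorem budget_three_sharp : ∃ g A s e n B cB : ℤ,
    2 * g = 2 * A + 2 * s + e ∧ g ≤ n ∧ n ≤ B + s + cB ∧ 2 * cB = e + 4 ∧ A = B + 2 :=
  ⟨2, 2, 0, 0, 2, 0, 2, by norm_num⟩

/-- Slack 1 is SHARP for the defect-0 target: at `2·c_B = e + 2` the hypotheses allow `A = B + 1`. -/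
theorem budget_one_sharp : ∃ g A s e n B cB : ℤ,
    2 * g = 2 * A + 2 * s + e ∧ g ≤ n ∧ n ≤ B + s + cB ∧ 2 * cB = e + 2 ∧ A = B + 1 :=
  ⟨1, 1, 0, 0, 1, 0, 1, by norm_num⟩

/-! ### §D  RIGIDITY OF THE 2-ADIC MODEL: same key ⟹ the twists are isomorphic over `ℚ₂` (PROVED) -/

open Literature.NumberTheory.QuadraticForms in
/-- `a ≡ 1 (mod 8)` ⟹ `a` is a square in `ℤ₂` — from the tree's `padicInt_isSquare_of_toZModPow_three_eq_one`
(Serre, *Cours d'arithmétique* II §3.3 Thm 4 `1 + 8ℤ₂ ⊆ ℤ₂²`). -/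
theorem isSquare_padicInt_two_of_modEq_one {a : ℤ} (h : a ≡ 1 [ZMOD 8]) : IsSquare (a : ℤ_[2]) := by
  apply padicInt_isSquare_of_toZModPow_three_eq_one
  rw [map_intCast]
  have h8 : ((a : ℤ) : ZMod 8) = ((1 : ℤ) : ZMod 8) := (ZMod.intCast_eq_intCast_iff a 1 8).mpr h
  rw [Int.cast_one] at h8
  exact h8

/-- square ratio ⟹ isomorphic twists, any field (tree `exists_variableChange_quadraticTwist_mul_sq`). -/
theorem exists_variableChange_twist_of_eq_mul_sq {F : Type*} [Field F] (V : WeierstrassCurve F)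
    {a b : F} (e : F) (he : e ≠ 0) (hab : a = b * e ^ 2) :
    ∃ C : WeierstrassCurve.VariableChange F, C • V.quadraticTwist b = V.quadraticTwist a := by
  subst hab
  exact V.exists_variableChange_quadraticTwist_mul_sq b e he

/-- **Model rigidity.** If `d₁ d₂` is a square in `ℚ₂` (`d₁, d₂ ≠ 0`) then `W^{(d₂)} ≅ W^{(d₁)}` over `ℚ₂`: every
purely 2-adic invariant of the member (reduction type, `W(ℚ₂)`, formal group, local root number, conductor
exponent, Tamagawa number at 2, the local Galois representation) is a function of the dyadic KEY. -/
theorem exists_variableChange_baseChange_two_of_isSquare (W : WeierstrassCurve ℚ) {d₁ d₂ : ℚ}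
    (hd₁ : d₁ ≠ 0) (hd₂ : d₂ ≠ 0) (hsq : IsSquare ((d₁ * d₂ : ℚ) : ℚ_[2])) :
    ∃ C : WeierstrassCurve.VariableChange ℚ_[2],
      C • (W.quadraticTwist d₂).baseChange ℚ_[2] = (W.quadraticTwist d₁).baseChange ℚ_[2] := by
  obtain ⟨r, hr⟩ := hsq
  rw [WeierstrassCurve.baseChange_quadraticTwist, WeierstrassCurve.baseChange_quadraticTwist]
  simp only [eq_ratCast]
  have hd₂' : ((d₂ : ℚ) : ℚ_[2]) ≠ 0 := by exact_mod_cast hd₂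
  have hd₁' : ((d₁ : ℚ) : ℚ_[2]) ≠ 0 := by exact_mod_cast hd₁
  have hr' : ((d₁ : ℚ) : ℚ_[2]) * ((d₂ : ℚ) : ℚ_[2]) = r * r := by
    have := hr
    push_cast at this
    exact this
  have hr0 : r ≠ 0 := by
    intro h0
    rw [h0, mul_zero] at hr'
    exact mul_ne_zero hd₁' hd₂' hr'
  refine exists_variableChange_twist_of_eq_mul_sq ((W.baseChange ℚ_[2])) (r / ((d₂ : ℚ) : ℚ_[2]))
    (div_ne_zero hr0 hd₂') ?_
  rw [div_pow, sq, ← hr']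
  field_simp

/-- Same ODD key (`d₁ d₂ ≡ 1 mod 8`) ⟹ isomorphic over `ℚ₂`. -/
theorem exists_variableChange_baseChange_two_of_modEq (W : WeierstrassCurve ℚ) {d₁ d₂ : ℤ}
    (hd₁ : d₁ ≠ 0) (hd₂ : d₂ ≠ 0) (h : d₁ * d₂ ≡ 1 [ZMOD 8]) :
    ∃ C : WeierstrassCurve.VariableChange ℚ_[2],
      C • (W.quadraticTwist (d₂ : ℚ)).baseChange ℚ_[2] = (W.quadraticTwist (d₁ : ℚ)).baseChange ℚ_[2] := by
  refine exists_variableChange_baseChange_two_of_isSquare W (by exact_mod_cast hd₁) (by exact_mod_cast hd₂) ?_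
  obtain ⟨s, hs⟩ := isSquare_padicInt_two_of_modEq_one h
  have hs' := congrArg (fun x : ℤ_[2] => (x : ℚ_[2])) hs
  push_cast at hs'
  refine ⟨(s : ℚ_[2]), ?_⟩
  push_cast
  exact hs'

/-- Same EVEN key (`d_i = 2 m_i`, `m₁ m₂ ≡ 1 mod 8`) ⟹ isomorphic over `ℚ₂` (`d₁ d₂ = (2s)²`). -/
theorem exists_variableChange_baseChange_two_of_modEq_even (W : WeierstrassCurve ℚ) {m₁ m₂ : ℤ}
    (hm₁ : m₁ ≠ 0) (hm₂ : m₂ ≠ 0) (h : m₁ * m₂ ≡ 1 [ZMOD 8]) :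
    ∃ C : WeierstrassCurve.VariableChange ℚ_[2],
      C • (W.quadraticTwist ((2 * m₂ : ℤ) : ℚ)).baseChange ℚ_[2] =
        (W.quadraticTwist ((2 * m₁ : ℤ) : ℚ)).baseChange ℚ_[2] := by
  refine exists_variableChange_baseChange_two_of_isSquare W (by exact_mod_cast (mul_ne_zero two_ne_zero hm₁))
    (by exact_mod_cast (mul_ne_zero two_ne_zero hm₂)) ?_
  obtain ⟨s, hs⟩ := isSquare_padicInt_two_of_modEq_one h
  have hs' := congrArg (fun x : ℤ_[2] => (x : ℚ_[2])) hs
  push_cast at hs'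
  refine ⟨2 * (s : ℚ_[2]), ?_⟩
  push_cast
  linear_combination (4 : ℚ_[2]) * hs'

/-- UNRAMIFIED PARTNERS (`d₁ d₂ ≡ 5 mod 8`, odd): `W^{(d₁)} ≅ W^{(5 d₂)} = (W^{(d₂)})^{(5)}` over `ℚ₂` — the two keys of
a δ-class differ exactly by the unramified quadratic twist (`ℚ₂(√5)` is the unramified quadratic extension). -/
theorem exists_variableChange_baseChange_two_of_modEq_five (W : WeierstrassCurve ℚ) {d₁ d₂ : ℤ}
    (hd₁ : d₁ ≠ 0) (hd₂ : d₂ ≠ 0) (h : d₁ * d₂ ≡ 5 [ZMOD 8]) :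
    ∃ C : WeierstrassCurve.VariableChange ℚ_[2],
      C • (W.quadraticTwist ((5 * d₂ : ℤ) : ℚ)).baseChange ℚ_[2] =
        (W.quadraticTwist (d₁ : ℚ)).baseChange ℚ_[2] := by
  refine exists_variableChange_baseChange_two_of_modEq W hd₁ (mul_ne_zero (by norm_num) hd₂) ?_
  have h25 : d₁ * (5 * d₂) = 5 * (d₁ * d₂) := by ring
  rw [h25]
  calc 5 * (d₁ * d₂) ≡ 5 * 5 [ZMOD 8] := h.mul_left 5
    _ ≡ 1 [ZMOD 8] := by decide

/-- and `(W^{(d)})^{(5)} = W^{(5d)}` on the nose (tree `quadraticTwist_quadraticTwist`). -/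
theorem quadraticTwist_five (W : WeierstrassCurve ℚ) (d : ℚ) :
    (W.quadraticTwist d).quadraticTwist 5 = W.quadraticTwist (d * 5) :=
  W.quadraticTwist_quadraticTwist d 5

/-! ### §E  The SHAPE + MEASURE frame and the assembled step -/

/-- Per-member ledger of the class (carrier `M` = minimal models `W ≅ cm7^{(d)}`, `r_an(W) = 1`, `d ≢ 1 (4)`): the
S2′ / chain symbols of the k1-g2 H6 shape. Nothing is asserted; the research items are the `Prop`s below. -/
structure ClassLedger (M : Type*) where
  /-- dyadic key of the member -/
  key : M → DyadicKey
  /-- analytic side `A(W)` (Ш_an currency, K₀-doubled inside `2·A`) and algebraic side `B(W)` -/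
  A : M → ℤ
  B : M → ℤ
  /-- S2′: `g(W)` = half-valuation of the Katz value at the member's point; `s(W)` = the member's own ledger
  (log of the generator, index, the EXPLICIT odd-prime digits of V2); `n(W)` = the characteristic-series side -/
  g : M → ℤ
  s : M → ℤ
  n : M → ℤ
  /-- the dyadic NET digit `e(W)` of S2′ — H_W's `c`, H_C's digits, (W-b)′'s constant, `ρ, ρ′, ε, ε′` all folded;
  OPAQUE: T3 typed as an equality says it EXISTS, not what it is -/
  e : M → ℤ
  /-- the algebraic per-key constant `c_B(k) ∋ t_v, k_v̄, e_ctrl` (T2⁻ / V1 / V2 tables) -/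
  cB : DyadicKey → ℤ

namespace ClassLedger

variable {M : Type*} (L : ClassLedger M)

/-- SHAPE (research = typing T3 as an EQUALITY with opaque constant; print «mod E^×»): S2′ per member. -/
def Shape : Prop := ∀ W, 2 * L.g W = 2 * L.A W + 2 * L.s W + L.e W

/-- the one-sided chain T1⁻ ∘ T2⁻ per member (certificates B-T2, B-V1, B-CV). -/
def Chain : Prop := ∀ W, L.g W ≤ L.n W ∧ L.n W ≤ L.B W + L.s W + L.cB (L.key W)

/-- KEY-RIGIDITY (the STUB-PLAN's standing «a number per key», T3.2/T3.4; model half = §D). -/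
def KeyRigid : Prop := ∀ W W', L.key W = L.key W' → L.e W = L.e W'

/-- δ-RIGIDITY (Plan 2, research-S): `e` is invariant under the UNRAMIFIED quadratic twist at 2. -/
def DeltaRigid : Prop := ∀ W W', (L.key W).delta = (L.key W').delta → L.e W = L.e W'

/-- an ANCHOR at key `k`: a member of that key whose digit has been MEASURED (certified `g, A, s` ⟹ `e = T k`). -/
def AnchoredAt (T : DyadicKey → ℤ) (k : DyadicKey) : Prop := ∃ W₀, L.key W₀ = k ∧ L.e W₀ = T k

theorem keyRigid_of_deltaRigid (h : L.DeltaRigid) : L.KeyRigid :=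
  fun W W' hk => h W W' (by rw [hk])

/-- at an anchor the digit is READ OFF the identity: `e = 2g − 2A − 2s` (the measurement M1 computes `g, A, s`). -/
theorem e_eq_of_shape (hS : L.Shape) (W₀ : M) : L.e W₀ = 2 * L.g W₀ - 2 * L.A W₀ - 2 * L.s W₀ := by
  have := hS W₀
  omega

/-- CALIBRATION, Plan 1: key-rigidity + one anchor per key ⟹ the NET table is a theorem. -/
theorem table_of_keyRigid (T : DyadicKey → ℤ) (hR : L.KeyRigid) (hA : ∀ k, L.AnchoredAt T k) :
    ∀ W, L.e W = T (L.key W) :=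
  eq_table_of_rigid_of_anchor L.key L.e T hR (fun W => by
    obtain ⟨W₀, hk, he⟩ := hA (L.key W)
    exact ⟨W₀, hk, by rw [he, hk]⟩)

/-- CALIBRATION, Plan 2: δ-rigidity + THREE anchors `(1,7), (0,7), (0,5)` ⟹ the table on all SIX keys
(`T` constant on δ-classes). -/
theorem table_of_deltaRigid (T : DyadicKey → ℤ) (hR : L.DeltaRigid) (hT : ∀ k, T k.unr = T k)
    (h17 : L.AnchoredAt T .k17) (h07 : L.AnchoredAt T .k07) (h05 : L.AnchoredAt T .k05) :
    ∀ W, L.e W = T (L.key W) := by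
  intro W
  obtain ⟨a, ha, hka⟩ := DyadicKey.anchor_cases (L.key W)
  have hanch : L.AnchoredAt T a := by
    rcases ha with rfl | rfl | rfl
    · exact h17
    · exact h07
    · exact h05
  obtain ⟨W₀, hk0, he0⟩ := hanch
  rcases hka with h | h
  · have hδ : (L.key W).delta = (L.key W₀).delta := by rw [h, hk0]
    rw [hR W W₀ hδ, he0, h]
  · have hδ : (L.key W).delta = (L.key W₀).delta := by rw [h, hk0, DyadicKey.delta_unr]
    rw [hR W W₀ hδ, he0, h, hT]

/-- THE STEP, assembled (target `LowerTwists₊₁`-shape through W0, R1 P-CT): SHAPE + CHAIN + calibrated table + the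
per-key budget with slack 3 ⟹ `A ≤ B + 1` for every member — six `decide`-able checks on ≤ three measured integers. -/
theorem lowerSucc_of_calibration (T : DyadicKey → ℤ) (hS : L.Shape) (hC : L.Chain)
    (htab : ∀ W, L.e W = T (L.key W)) (hbudget : ∀ k, 2 * L.cB k ≤ T k + 3) :
    ∀ W, L.A W ≤ L.B W + 1 := by
  intro W
  have h1 := hS W
  have h2 := (hC W).1
  have h3 := (hC W).2
  have h4 := htab W
  have h5 := hbudget (L.key W)
  omega

/-- the defect-0 variant (T0 alone, no P-CT): slack 1. -/
theorem lower_of_calibration (T : DyadicKey → ℤ) (hS : L.Shape) (hC : L.Chain)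
    (htab : ∀ W, L.e W = T (L.key W)) (hbudget : ∀ k, 2 * L.cB k ≤ T k + 1) :
    ∀ W, L.A W ≤ L.B W := by
  intro W
  have h1 := hS W
  have h2 := (hC W).1
  have h3 := (hC W).2
  have h4 := htab W
  have h5 := hbudget (L.key W)
  omega

/-- END TO END (Plan 1 ∘ Plan 2 ∘ Plan 3): SHAPE ∧ δ-RIGIDITY ∧ three anchors ∧ the relaxed budget ⟹ `A ≤ B + 1`. -/
theorem lowerSucc_of_deltaRigid_of_anchors (T : DyadicKey → ℤ) (hS : L.Shape) (hC : L.Chain)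
    (hR : L.DeltaRigid) (hT : ∀ k, T k.unr = T k)
    (h17 : L.AnchoredAt T .k17) (h07 : L.AnchoredAt T .k07) (h05 : L.AnchoredAt T .k05)
    (hbudget : ∀ k, 2 * L.cB k ≤ T k + 3) : ∀ W, L.A W ≤ L.B W + 1 :=
  L.lowerSucc_of_calibration T hS hC (L.table_of_deltaRigid T hR hT h17 h07 h05) hbudget

end ClassLedger

/-! ### §F  A toy instance of the budget check (shape only; the real `T` comes from the three measurements) -/

/-- Example: with the V1/T2⁻ torsion-type constants `c_B = (2, 3, ·, 1+?, ·, ·)`-shaped tables, the relaxed budget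
`2·c_B(k) ≤ T(k) + 3` on key `(1,3)` (`c_B = 3`) asks only `T(−1-class) ≥ 3`, where T3.5's slack-1 form asked `≥ 5`;
both are decided by the ONE anchor `cm7^{(−1)}` (N = 784) of the δ = −1 class. Pure arithmetic: -/
example (T : ℤ) (h : 3 ≤ T) : 2 * (3 : ℤ) ≤ T + 3 := by omega
example (T : ℤ) (h : 2 * (3 : ℤ) ≤ T + 1) : 5 ≤ T := by omega

end Summit.BirchSwinnertonDyer.BirchSwinnertonDyer.Cruxes.SplitBadTwoLowerHalfOfFacts.StubIdeasK1G8

end
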